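import Summits.Langlands.Langlands.Theorems.SqrtFiveQuarticCoversRank0TwentyOneTwist525Local
import HarnessLib

/-!
# Route `Langlands/SqrtFiveQuarticCovers` — rank `0` of the quadratic twist of `X₀(21)` by `5`:
# `T₅₂₅ : y² = x³ + 5x² − 1600x − 8000 = (x + 5)(x − 40)(x + 40)` has finitely many rational points

Cell lg-quartmod (F-L1), seat eng-8 g4 (self-scoped optional item (E21) under the wind-down ruling
director-frontier g15 2026-08-29T00:46:47Z (a); helper of stmt-Langlands-23416).  The fourth lineage
E10X of sheet 4.5 (eng-1 g3, E10X-REPORT 21347fd33ceba04b: a Hecke correspondence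
`X(b3,e7) → X₀(21) = 21a1` computed exactly) NAMES «rank `0` of `49a4`, `49a4 ⊗ χ₅`, `21a1`,
`21a1 ⊗ χ₅` over `ℚ`» (exact `L`-values + Kolyvagin–Logachev).  The first two are kernel theorems
since 2026-08-29 (`W_ratPoints` p679899, `W5Descent.ratPoints` p680761, `MordellWeilE7` p682119);
`rank 21a1(ℚ) = 0` is the tree's `Curve21A1.finite_point` (complete `2`-descent, even the point list
`Curve21A1.mem_points_of_equation`); the missing piece is the twist, proved here:
`Twist525.finite_point : Finite (T₅₂₅)(ℚ)`, `T₅₂₅ = ⟨0, 5, 0, -1600, -8000⟩ = (X₀(21)).quadraticTwist 5`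
up to `u = 1/2` (`X₀(21) = 21A1 = [1, 0, 0, -4, -1]`, split model `Y² = (X + 1)(X − 8)(X + 8)`; twist
`5Y² = …`, rescale by `5`: roots `−5, 40, −40`), conductor `525 = 3·5²·7`, torsion `ℤ/2 × ℤ/2`.
Companion: `…Rank0TwentyOneSqrtFive.lean` («`X₀(21)(K)` finite for quadratic `K ∋ √5`»).

METHOD (the tree's `…Rank0FifteenTwist75.lean` p682211 VERBATIM; Silverman *AEC* Prop. X.1.4 /
Example X.1.5, `S = {2, 3, 5, 7, ∞}`), components `(x + 5, x − 40)`: the arithmetic core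
`Twist525.exists_sq_of_sq_eq` (module `…Twist525Local`: valuation parities, the `3`-adic link
`ord_3(x + 5) ≡ ord_3(x − 40)`, signs, eighteen congruence obstructions by `decide` over
`ZMod 16 / 9 / 7`) puts the `2`-descent pair of every rational point in
`S = {(1, 1), (5, 1), ([−7], [−5]), ([−35], [−5])}` (`descentPair_mem`) = the classes of
`O, (40, 0), (−5, 0), (−40, 0)`, so `2^(r+2) ≤ 4` (`pow_finrank_add_two_le_natCard_range` with
`T₁ = (−5, 0)`, `T₂ = (40, 0)`), `r = 0`, and `T₅₂₅(ℚ)` is finite by the tree's Mordell–Weil theorem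
(`module_finite_point_holds`, `finite_point_of_mordellWeilRank_eq_zero`).  Sharpness numerics:
HOME/lg-quartmod-eng-8/g4/code/e21/ (scope525.py: exactly the four torsion classes survive the local
tests at `2, 3, 5, 7, ∞`; cell record `L(21a ⊗ χ₅, 1) = 1.61396 ≠ 0`, eng-1 jobE).

HONEST STATUS: an unconditional kernel theorem about the rational points of ONE explicit elliptic curve
over `ℚ` (conductor `525`); not a BSD or modularity statement; it closes no binder of the route's Record
(it turns a NAMED rank-`0` input used inside one lineage document of sheet 4.5 into a kernel theorem);
nothing here proves modularity of a new class of elliptic curves.  References: [SilvermanAEC2009]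
Prop. X.1.4, Example X.1.5, Thm. VIII.6.7; [CremonaAlgorithms1997] Table 1 (`N = 21`) and §3.6.
-/

noncomputable section

open WeierstrassCurve WeierstrassCurve.Affine WeierstrassCurve.Affine.Point

set_option linter.dupNamespace false -- project-wide option; `Summit.Langlands.Langlands` is the mandated namespace

namespace Summit.Langlands.Langlands.Theorems.SqrtFiveQuarticCovers

namespace Twist525

open Literature.NumberTheory.EllipticCurves Literature.NumberTheory.EllipticCurves.Curve24A1
  Literature.NumberTheory.EllipticCurves.Curve15A1

/-! ### The curve `T₅₂₅`: equation, rational `2`-torsion `−5, 40, −40`, the `2`-descent -/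

/-- A solution of `y² = x³ + 5x² − 1600x − 8000` is an affine point of `T₅₂₅` (the affine
equation, in the direction used to exhibit the torsion points). [folklore] -/
theorem equation_of_eq {x y : ℚ} (h : y ^ 2 = x ^ 3 + 5 * x ^ 2 - 1600 * x - 8000) :
    (⟨0, 5, 0, -1600, -8000⟩ : WeierstrassCurve ℚ).toAffine.Equation x y := by
  rw [Affine.equation_iff]
  linear_combination h

/-- The affine equation of `T₅₂₅` read as `y² = x³ + 5x² − 1600x − 8000`. [folklore] -/
theorem eq_of_equation {x y : ℚ}
    (h : (⟨0, 5, 0, -1600, -8000⟩ : WeierstrassCurve ℚ).toAffine.Equation x y) :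
    y ^ 2 = x ^ 3 + 5 * x ^ 2 - 1600 * x - 8000 := by
  rw [Affine.equation_iff] at h
  linear_combination h

/-- `T₅₂₅` has rational `2`-torsion with `e₁ = −5, e₂ = 40, e₃ = −40`: the `2`-division cubic is
`4x³ + b₂x² + 2b₄x + b₆ = 4x³ + 20x² − 6400x − 32000 = 4(x + 5)(x − 40)(x + 40)`, the
hypothesis `SplitTwoTorsion` of the tree's complete `2`-descent. [folklore] -/
theorem splitTwoTorsion :
    (⟨0, 5, 0, -1600, -8000⟩ : WeierstrassCurve ℚ).toAffine.SplitTwoTorsion (-5) 40 (-40) := by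
  refine ⟨?_, ?_, ?_⟩ <;> norm_num [b₂, b₄, b₆]

/-- An affine point of `T₅₂₅` with `y = 0` is one of the three `2`-torsion points,
`x ∈ {−5, 40, −40}`. [folklore] -/
theorem x_eq_of_eq_zero {x y : ℚ}
    (h : (⟨0, 5, 0, -1600, -8000⟩ : WeierstrassCurve ℚ).toAffine.Equation x y) (hy : y = 0) :
    x = -5 ∨ x = 40 ∨ x = -40 := by
  have hE := eq_of_equation h
  rw [hy] at hE
  have hfac : (x + 5) * ((x - 40) * (x + 40)) = 0 := by linear_combination -hE
  rcases mul_eq_zero.mp hfac with h1 | h23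
  · exact Or.inl (by linarith)
  · rcases mul_eq_zero.mp h23 with h2 | h3
    · exact Or.inr (Or.inl (by linarith))
    · exact Or.inr (Or.inr (by linarith))

/-- **The image of the complete `2`-descent on `T₅₂₅`** (Silverman, *AEC*, Prop. X.1.4 and
Example X.1.5): for every rational point `P`, the pair of descent components
`(δ₁(P), δ₂(P)) = (x + 5, x − 40) ∈ ℚˣ/ℚˣ² × ℚˣ/ℚˣ²` (with the conventions at `O` and the `2`-torsion
points) is one of the four classes `(1, 1), (5, 1), (−7, −5), (−35, −5)`.  Polymorphic in the
`DecidableEq ℚ` argument of the tree's `twoDescentComponent`. [cite: SilvermanAEC2009, Prop. X.1.4 and Example X.1.5] -/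
theorem descentPair_mem [DecidableEq ℚ]
    (P : (⟨0, 5, 0, -1600, -8000⟩ : WeierstrassCurve ℚ).toAffine.Point) :
    (twoDescentComponent (⟨0, 5, 0, -1600, -8000⟩ : WeierstrassCurve ℚ).toAffine (-5) 40 (-40) P,
      twoDescentComponent (⟨0, 5, 0, -1600, -8000⟩ : WeierstrassCurve ℚ).toAffine 40 (-5) (-40) P)
      ∈ ({(1, 1), (sqClass 5, 1), (sqClass (-7), sqClass (-5)), (sqClass (-35), sqClass (-5))} :
        Set (SqUnits ℚ × SqUnits ℚ)) := by
  simp only [Set.mem_insert_iff, Set.mem_singleton_iff, Prod.mk.injEq]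
  rcases P with _ | ⟨x, y, hP⟩
  · exact Or.inl ⟨rfl, rfl⟩
  · by_cases hx1 : x = -5
    · subst hx1
      refine Or.inr (Or.inr (Or.inl ⟨?_, ?_⟩))
      · rw [twoDescentComponent_some_of_eq hP rfl,
          show ((-5 : ℚ) - 40) * (-5 - (-40)) = -7 * 15 ^ 2 by norm_num,
          sqClass_mul_sq (by norm_num) (by norm_num)]
      · rw [twoDescentComponent_some_of_ne hP (by norm_num),
          show (-5 : ℚ) - 40 = -5 * 3 ^ 2 by norm_num, sqClass_mul_sq (by norm_num) (by norm_num)]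
    by_cases hx2 : x = 40
    · subst hx2
      refine Or.inr (Or.inl ⟨?_, ?_⟩)
      · rw [twoDescentComponent_some_of_ne hP (by norm_num),
          show (40 : ℚ) - (-5) = 5 * 3 ^ 2 by norm_num, sqClass_mul_sq (by norm_num) (by norm_num)]
      · rw [twoDescentComponent_some_of_eq hP rfl,
          show ((40 : ℚ) - (-5)) * (40 - (-40)) = 60 ^ 2 by norm_num, sqClass_sq]
    by_cases hx3 : x = -40
    · subst hx3
      refine Or.inr (Or.inr (Or.inr ⟨?_, ?_⟩))
      · rw [twoDescentComponent_some_of_ne hP (by norm_num),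
          show (-40 : ℚ) - (-5) = -35 * 1 ^ 2 by norm_num, sqClass_mul_sq (by norm_num) (by norm_num)]
      · rw [twoDescentComponent_some_of_ne hP (by norm_num),
          show (-40 : ℚ) - 40 = -5 * 4 ^ 2 by norm_num, sqClass_mul_sq (by norm_num) (by norm_num)]
    have hy : y ≠ 0 := fun hy => by
      rcases x_eq_of_eq_zero hP.1 hy with h | h | h
      · exact hx1 h
      · exact hx2 h
      · exact hx3 h
    obtain ⟨u, w, hu, hw, h12⟩ := exists_sq_of_sq_eq hy (eq_of_equation hP.1)
    rw [twoDescentComponent_some_of_ne hP hx1, twoDescentComponent_some_of_ne hP hx2,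
      show x - (-5) = x + 5 by ring]
    rcases h12 with ⟨h1 | h1, h2⟩ | ⟨h1 | h1, h2⟩
    · refine Or.inl ⟨?_, ?_⟩
      · rw [h1, sqClass_sq]
      · rw [h2, sqClass_sq]
    · refine Or.inr (Or.inl ⟨?_, ?_⟩)
      · rw [h1, sqClass_mul_sq (by norm_num) hu]
      · rw [h2, sqClass_sq]
    · refine Or.inr (Or.inr (Or.inl ⟨?_, ?_⟩))
      · rw [h1, sqClass_mul_sq (by norm_num) hu]
      · rw [h2, sqClass_mul_sq (by norm_num) hw]
    · refine Or.inr (Or.inr (Or.inr ⟨?_, ?_⟩))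
      · rw [h1, sqClass_mul_sq (by norm_num) hu]
      · rw [h2, sqClass_mul_sq (by norm_num) hw]

/-! ### Rank zero: `T₅₂₅(ℚ)` is finite -/

/-- **`T₅₂₅` (the twist of `X₀(21)` by `5`, conductor `525`) has Mordell–Weil rank `0`: `T₅₂₅(ℚ)` is
finite**, proved by the complete `2`-descent (Silverman, *AEC*, Prop. X.1.4, Example X.1.5): the
`2`-descent map `δ` (tree `twoDescentMap`, kernel `2E(ℚ)`) takes at most the `4` values of
`descentPair_mem`, while by the counting lemma `pow_finrank_add_two_le_natCard_range` (with the
`2`-torsion points `T₁ = (−5, 0)`, `T₂ = (40, 0)`, which `δ` separates: `δ(T₁) = (−1575, −45)`,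
`δ(T₂) = (45, 3600)`, `δ(T₁ + T₂) = (−70875, −162000)`, and `−45`, `45 = 5·3²`, `−70875` are not
rational squares) it takes at least `2^(r + 2)` values, `r = rank_ℤ E(ℚ)` (Mordell–Weil, tree
`module_finite_point_holds`); so `r = 0` and `E(ℚ)` is finite (`finite_point_of_mordellWeilRank_eq_zero`).
[cite: SilvermanAEC2009, Prop. X.1.4 and Example X.1.5 (method); CremonaAlgorithms1997, Table 1, N = 21 (the curve twisted)] -/
theorem finite_point : Finite (⟨0, 5, 0, -1600, -8000⟩ : WeierstrassCurve ℚ).toAffine.Point := by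
  letI := Classical.decEq ℚ
  -- `Δ = 16·(45·35·80)² = 254016000000 ≠ 0`
  haveI : (⟨0, 5, 0, -1600, -8000⟩ : WeierstrassCurve ℚ).IsElliptic :=
    ⟨by
      rw [show (⟨0, 5, 0, -1600, -8000⟩ : WeierstrassCurve ℚ).Δ = 254016000000 by
        norm_num [WeierstrassCurve.Δ, b₂, b₄, b₆, b₈]]
      norm_num⟩
  haveI : Module.Finite ℤ (⟨0, 5, 0, -1600, -8000⟩ : WeierstrassCurve ℚ).toAffine.Point :=
    WeierstrassCurve.module_finite_point_holds (W := ⟨0, 5, 0, -1600, -8000⟩)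
  have h := splitTwoTorsion
  set ψ := twoDescentMap h with hψ
  -- the `2`-torsion points `T₁ = (-5, 0)`, `T₂ = (40, 0)`
  have hns : ∀ {a b : ℚ}, (⟨0, 5, 0, -1600, -8000⟩ : WeierstrassCurve ℚ).toAffine.Equation a b →
      (⟨0, 5, 0, -1600, -8000⟩ : WeierstrassCurve ℚ).toAffine.Nonsingular a b :=
    fun hab => equation_iff_nonsingular.mp hab
  have hT₁ := hns (equation_of_eq (x := -5) (y := 0) (by norm_num))
  have hT₂ := hns (equation_of_eq (x := 40) (y := 0) (by norm_num))
  set T₁ := Point.some (-5) 0 hT₁ with hT₁def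
  set T₂ := Point.some 40 0 hT₂ with hT₂def
  have h12 : (-5 : ℚ) ≠ 40 := by norm_num
  have h21 : (40 : ℚ) ≠ -5 := by norm_num
  -- negative numbers and `5` are not squares
  have hnegsq : ∀ {c : ℚ}, c < 0 → sqClass c ≠ 1 := fun hc h1 => by
    obtain ⟨v, hv⟩ := (sqClass_eq_one_iff hc.ne).mp h1
    nlinarith [sq_nonneg v]
  have h5 : sqClass (5 : ℚ) ≠ 1 := fun h1 => by
    obtain ⟨v, hv⟩ := (sqClass_eq_one_iff (by norm_num)).mp h1
    exact five_ne_sq v hv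
  have hψT₁ : ψ T₁ = Additive.ofMul (sqClass ((-5 - 40) * (-5 - (-40))), sqClass (-5 - 40)) := by
    rw [hψ, twoDescentMap_apply, twoDescentComponent_some_of_eq hT₁ rfl,
      twoDescentComponent_some_of_ne hT₁ h12]
  have hψT₂ : ψ T₂ = Additive.ofMul (sqClass (40 - (-5)), sqClass ((40 - (-5)) * (40 - (-40)))) := by
    rw [hψ, twoDescentMap_apply, twoDescentComponent_some_of_ne hT₂ h21,
      twoDescentComponent_some_of_eq hT₂ rfl]
  have h₁ : ψ T₁ ≠ 0 := by
    rw [hψT₁, Ne, ofMul_eq_zero, Prod.mk_eq_one, not_and_or]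
    exact Or.inr (hnegsq (by norm_num))
  have h₂ : ψ T₂ ≠ 0 := by
    rw [hψT₂, Ne, ofMul_eq_zero, Prod.mk_eq_one, not_and_or]
    refine Or.inl ?_
    rw [show (40 : ℚ) - (-5) = 5 * 3 ^ 2 by norm_num, sqClass_mul_sq (by norm_num) (by norm_num)]
    exact h5
  have h₃ : ψ (T₁ + T₂) ≠ 0 := by
    rw [map_add, hψT₁, hψT₂, ← ofMul_mul, Prod.mk_mul_mk, Ne, ofMul_eq_zero, Prod.mk_eq_one,
      not_and_or]
    refine Or.inl ?_
    rw [← sqClass_mul (by norm_num) (by norm_num)]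
    exact hnegsq (by norm_num)
  have h₁₂ : ψ T₁ ≠ ψ T₂ := by
    rw [hψT₁, hψT₂, Ne, Additive.ofMul.apply_eq_iff_eq, Prod.mk.injEq, not_and_or]
    refine Or.inr fun heq => hnegsq (c := (-5 : ℚ) - 40) (by norm_num) ?_
    rw [heq, show ((40 : ℚ) - (-5)) * (40 - (-40)) = 60 ^ 2 by norm_num, sqClass_sq]
  have hker : ∀ a, ψ a = 0 → ∃ b, a = 2 • b := fun a ha => by
    have ha' : a ∈ ψ.ker := ha
    rw [hψ, ker_twoDescentMap h] at ha'
    obtain ⟨b, hb⟩ := ha'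
    exact ⟨b, hb.symm⟩
  have hfin₁ : IsOfFinAddOrder T₁ := by
    refine isOfFinAddOrder_iff_nsmul_eq_zero.mpr ⟨2, two_pos, ?_⟩
    rw [two_nsmul, hT₁def]
    exact add_self_of_Y_eq (by norm_num [negY])
  have hfin₂ : IsOfFinAddOrder T₂ := by
    refine isOfFinAddOrder_iff_nsmul_eq_zero.mpr ⟨2, two_pos, ?_⟩
    rw [two_nsmul, hT₂def]
    exact add_self_of_Y_eq (by norm_num [negY])
  -- the range of `ψ` has at most `4` elements
  set S : Set (SqUnits ℚ × SqUnits ℚ) := {(1, 1), (sqClass 5, 1), (sqClass (-7), sqClass (-5)),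
    (sqClass (-35), sqClass (-5))} with hS
  have hSfin : S.Finite := (((Set.finite_singleton _).insert _).insert _).insert _
  have hS4 : S.ncard ≤ 4 := by
    rw [hS]
    refine (Set.ncard_insert_le _ _).trans ?_
    refine (Nat.add_le_add_right (Set.ncard_insert_le _ _) 1).trans ?_
    refine (Nat.add_le_add_right (Nat.add_le_add_right (Set.ncard_insert_le _ _) 1) 1).trans ?_
    rw [Set.ncard_singleton]
  have hsub : Set.range ψ ⊆ Additive.ofMul '' S := by
    rintro _ ⟨P, rfl⟩
    exact ⟨_, descentPair_mem P, by rw [hψ]; exact (twoDescentMap_apply h P).symm⟩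
  have hTfin : (Additive.ofMul '' S).Finite := hSfin.image _
  haveI : Finite ψ.range := (hTfin.subset (by rw [AddMonoidHom.coe_range]; exact hsub)).to_subtype
  have hcard : Nat.card ψ.range ≤ 4 := by
    rw [← SetLike.coe_sort_coe, Nat.card_coe_set_eq, AddMonoidHom.coe_range]
    calc (Set.range ψ).ncard ≤ (Additive.ofMul '' S).ncard := Set.ncard_le_ncard hsub hTfin
      _ ≤ S.ncard := Set.ncard_image_le hSfin
      _ ≤ 4 := hS4
  have hbound := pow_finrank_add_two_le_natCard_range ψ hker hfin₁ hfin₂ h₁ h₂ h₃ h₁₂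
  have hr : (⟨0, 5, 0, -1600, -8000⟩ : WeierstrassCurve ℚ).mordellWeilRank = 0 := by
    have hle :
        2 ^ (Module.finrank ℤ (⟨0, 5, 0, -1600, -8000⟩ : WeierstrassCurve ℚ).toAffine.Point + 2) ≤
          2 ^ 2 := hbound.trans hcard
    have := (Nat.pow_le_pow_iff_right (by norm_num)).mp hle
    unfold WeierstrassCurve.mordellWeilRank
    omega
  exact WeierstrassCurve.finite_point_of_mordellWeilRank_eq_zero _ hr

end Twist525

end Summit.Langlands.Langlands.Theorems.SqrtFiveQuarticCovers

end
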